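import Summits.QuantumFields.YangMills.Theorems.BalabanUVNodesN15KingModelLandauFlux
import Summits.QuantumFields.YangMills.Theorems.BalabanUVNodesN15KingModelCurvatureDeterminant
import HarnessLib

/-!
# BalabanUVNodes ∕ N15 — THE KING-MODEL RUNG (PART Ϡ-e): THE LANDAU MASS IS GAUGE INVARIANT AND STABLE — coercivity constants of `−cΔ_U+m²` are GAUGE INVARIANT and `4(d+1)c`-LIPSCHITZ in
# the sup distance of the link fields; hence every `U(1)` field within `ε` (bondwise) of the GAUGE ORBIT of the Landau-gauge constant-flux field has the curvature mass `c·Λ(p′) − 4(d+1)cε`;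
# the curved Gaussian normalisation `det(−cΔ_U+m²) ≥ (m² + cΛ(p′))^{|T|}`
# (Track A, DAG node N15 = NE2; FAN-OUT v1.1 §N15 s3 «KING-MODEL RUNG … + what the curved case adds»; count-neutral)

HONEST FRAMING.  Count-neutral (cell `pub-ymgap`, seat `pub-ymgap-dag-n15-e` g47; `--supports stmt-QuantumFields-27247 --as helper` = K3ᴬ, KEY MAP v3).  King's fine covariance layer
`−cΔ_U + m²` ([King1986] (4.4) p.670; [Balaban1985BackgroundPropagators] (3.3) p.391, (3.23) p.394, gauge transformations p.398 l.19) on ONE finite torus; elementary.  NOT Bałaban's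
`G_k(U)`; NOT [Balaban1985BackgroundPropagators] (3.42); NOT a node discharge (N15 of record untouched); nothing continuum ∕ ℝ⁴ ∕ OS ∕ Clay.

THE RESULTS (`K` any period vector; unitary link fields; fibre `𝕜ⁿ` in §1, `U(1)` in §2–§3):
* §1 GENERIC (any fibre): `sum_norm_fib_sq_gauge` (`Σ‖(D_g^*v)_x‖² = Σ‖v_x‖²`), `star_dotProduct_conj_mulVec` (`⟨v, D M D^* v⟩ = ⟨D^*v, M D^*v⟩`), ★★ **`coercive_kingGaugeAct`** (a form bound
  `κ·Σ‖v_x‖² ≤ Re⟨v,(−cΔ_U+m²)v⟩` passes to `U^g` with the SAME `κ` — coercivity constants are gauge invariant, Ͱ-a `covLapF_kingGaugeAct`), `sq_ge_sq_sub_of_ge_sub` (real lemma),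
  `norm_covDiff_ge_of_near` (one bond: `‖v_x − Vv_y‖² ≥ ‖v_x − Uv_y‖² − 2ε‖v_y‖(‖v_x‖+‖v_y‖)` when `‖V − U‖ ≤ ε`), ★★ **`re_quadForm_covLapF_ge_of_near`** (COERCIVITY IS LIPSCHITZ IN THE
  FIELD: `κ` for `U` and `‖V_b − U_b‖ ≤ ε` on every bond ⟹ `κ − 4(d+1)cε` for `V`), ★ `pow_le_re_det_covLapF_of_coercive` (`κ ≥ 0` ⟹ `κ^{|T×n|} ≤ Re det(−cΔ_U+m²)`, Ϳ-m's engine made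
  `κ`-abstract).
* §2 THE LANDAU MASS ON THE GAUGE ORBIT AND NEAR IT (`U(1)`, `U₀ = fluxLink p ν₁`, `p_{ν₁} = 0`, `ν₀ ≠ ν₁`, `c ≥ 0`): ★★ `re_quadForm_covLapF_ge_landau_gauge` (every gauge transform `U₀^g`:
  `m² + cΛ(p′_{ν₀})`), ★★★ **`re_quadForm_covLapF_ge_landau_near_orbit`** (every unitary `V` with `‖V_b − (U₀^g)_b‖ ≤ ε` on all bonds: `m² + cΛ(p′_{ν₀}) − 4(d+1)cε`), ★★
  **`posDef_covLapF_massless_near_landau_orbit`** (`c > 0`, `|p′| ≤ 1`, `p_{ν₀} ≠ 0`, `ε < Λ(p′)∕(4(d+1))`: the MASSLESS covariant Laplacian is positive definite on an `ε`-TUBE around the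
  whole gauge orbit of the flux field — an open set of genuinely non-constant-curvature `U(1)` fields with a linear-in-flux gap), ★★ `l2_opNorm_covLapF_inv_le_near_landau_orbit`.
* §3 ★★ **`pow_landau_le_re_det_covLapF_fluxLink`** (`(m² + cΛ(p′))^{|T|} ≤ Re det(−cΔ_{U₀}+m²)`, `m² + cΛ ≥ 0`), ★ `pow_landau_le_re_det_near_orbit`, ★ `re_det_covLapF_massless_pos_near_orbit`
  (the massless curved normalisation is `> 0` on the tube; at `U ≡ 1` it is `0`).
PRIOR TREE ART (by name): Ϡ-a (`landauGap`, `landauGap_pos`), Ϡ-c (`re_quadForm_covLapF_fluxLink_ge_landau`, `posDef_covLapF_of_coercive`, `l2_opNorm_covLapF_inv_le_of_coercive`,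
`eigenvalues_covLapF_ge_of_coercive`, `landauGap_sOf_pos`), Ͱ-a (`covLapF`, `kingGaugeMat`, `kingGaugeAct`, `covLapF_kingGaugeAct`, `kingGaugeMat_mem_unitaryGroup`, `kingGaugeAct_mem_unitaryGroup`),
Ͱ-b (`fib`, `norm_toEuclideanLin_of_mem_unitaryGroup`), Ͱ-d (`re_quadForm_covLapF`), Ͱ-f (`sum_norm_fib_sq`, `sum_norm_fib_add_unitVec`), Ͱ-k (`l2_opNorm_of_mem_unitaryGroup_le` not needed), Ϳ-m
(`det_covLapF_eq_ofReal_prod`, `prod_eigenvalues_ge_pow`), Ͻ-q (`fluxLink`, `fluxLink_mem_unitaryGroup`), Mathlib (`Matrix.toLpLin_toLp`, `Matrix.star_mulVec`, `Matrix.dotProduct_mulVec`,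
`Matrix.l2_opNorm_mulVec`).  Dedup (rg at filing): basename 0 files; needles `coercive_kingGaugeAct|re_quadForm_covLapF_ge_of_near|_near_orbit|pow_le_re_det_covLapF_of_coercive|sum_norm_fib_sq_gauge` 0 tree files.
Locators: [Balaban1985BackgroundPropagators] p.398 l.19 (gauge transformations), (3.23) p.394, (3.35)–(3.37) p.397 (the regular regime as an open condition); [King1986] (4.4) p.670, (2.12)
p.653; [Balaban1982Higgs2] (3.38) p.591 (Gaussian normalisation); [DodziukMathai2006] §1 Cor 1.3 (notion).  0 `sorry`, 0 `def`.
-/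

noncomputable section
open scoped BigOperators ComplexConjugate ComplexOrder InnerProductSpace Matrix.Norms.L2Operator
open Finset Matrix WithLp

namespace Summit.QuantumFields.YangMills.BalabanUVNodes.N15KingModelRung.Landau

open Literature.MathematicalPhysics.QuantumFieldTheory.Balaban1983to89.B5Prop11Plancherel (Tor unitVec sOf)
open Summit.QuantumFields.YangMills.BalabanUVNodes.N15KingModelRung.Covariant (covLapF fib fib_apply isHermitian_covLapF re_quadForm_covLapF sum_norm_fib_sq sum_norm_fib_add_unitVec
  kingGaugeMat kingGaugeAct covLapF_kingGaugeAct kingGaugeMat_mem_unitaryGroup kingGaugeAct_mem_unitaryGroup norm_toEuclideanLin_of_mem_unitaryGroup)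
open Summit.QuantumFields.YangMills.BalabanUVNodes.N15KingModelRung.Cover (fluxLink fluxLink_mem_unitaryGroup)
open Summit.QuantumFields.YangMills.BalabanUVNodes.N15KingModelRung.Curvature (det_covLapF_eq_ofReal_prod prod_eigenvalues_ge_pow)

variable {d : ℕ} (K : Fin (d + 1) → ℕ)

/-! ## §1 Generic: gauge invariance and Lipschitz stability of coercivity; the determinant -/

section Generic

variable {𝕜 : Type*} [RCLike 𝕜] {n : Type*} [Fintype n] [DecidableEq n]
variable [hK : ∀ μ, NeZero (K μ)] {c m2 : ℝ}

/-- `Σ_x‖(Wv)_x‖² = Σ_x‖v_x‖²` for a unitary `W` on `ℓ²(T × n)` (in particular `W = D_g^*`). [folklore] -/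
theorem sum_norm_fib_sq_unitary {W : Matrix (Tor K × n) (Tor K × n) 𝕜} (hW : W ∈ Matrix.unitaryGroup (Tor K × n) 𝕜) (v : Tor K × n → 𝕜) :
    ∑ x, ‖fib K (W *ᵥ v) x‖ ^ 2 = ∑ x, ‖fib K v x‖ ^ 2 := by
  have h := norm_toEuclideanLin_of_mem_unitaryGroup hW (toLp 2 v)
  rw [Matrix.toLpLin_apply, ofLp_toLp] at h
  rw [sum_norm_fib_sq, sum_norm_fib_sq, h]

omit [DecidableEq n] in
/-- `⟨v, (A·M·Aᴴ)v⟩ = ⟨Aᴴv, M(Aᴴv)⟩` (`star v ⬝ᵥ` form). [folklore] -/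
theorem star_dotProduct_conj_mulVec (A M : Matrix (Tor K × n) (Tor K × n) 𝕜) (v : Tor K × n → 𝕜) :
    star v ⬝ᵥ ((A * M * Aᴴ) *ᵥ v) = star (Aᴴ *ᵥ v) ⬝ᵥ (M *ᵥ (Aᴴ *ᵥ v)) := by
  rw [← mulVec_mulVec, ← mulVec_mulVec, dotProduct_mulVec, star_mulVec, conjTranspose_conjTranspose]

/-- ★★ **COERCIVITY CONSTANTS ARE GAUGE INVARIANT**: if `κ·Σ‖v_x‖² ≤ Re⟨v,(−cΔ_U+m²)v⟩` for all `v` then the same holds for `U^g` (unitary `g`): `M_{U^g} = D_gM_UD_g^*` and `D_g^*` preserves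
`Σ‖v_x‖²`. [cite: Balaban1985BackgroundPropagators, p.398 l.19] -/
theorem coercive_kingGaugeAct (c m2 : ℝ) {U : Tor K × Fin (d + 1) → Matrix n n 𝕜} {g : Tor K → Matrix n n 𝕜} (hg : ∀ x, g x ∈ Matrix.unitaryGroup n 𝕜) {κ : ℝ}
    (hcoer : ∀ v : Tor K × n → 𝕜, κ * ∑ x, ‖fib K v x‖ ^ 2 ≤ RCLike.re (star v ⬝ᵥ (covLapF K c m2 U *ᵥ v))) (v : Tor K × n → 𝕜) :
    κ * ∑ x, ‖fib K v x‖ ^ 2 ≤ RCLike.re (star v ⬝ᵥ (covLapF K c m2 (kingGaugeAct K g U) *ᵥ v)) := by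
  rw [covLapF_kingGaugeAct K c m2 hg U, star_dotProduct_conj_mulVec]
  have hD : (kingGaugeMat K g)ᴴ ∈ Matrix.unitaryGroup (Tor K × n) 𝕜 := by
    simpa only [star_eq_conjTranspose] using Unitary.star_mem (kingGaugeMat_mem_unitaryGroup K hg)
  rw [← sum_norm_fib_sq_unitary K hD v]
  exact hcoer _

omit hK in
/-- Real lemma: `0 ≤ a`, `0 ≤ t`, `0 ≤ b`, `b ≥ a − t` ⟹ `b² ≥ a² − 2at`. [folklore] -/
theorem sq_ge_sq_sub_of_ge_sub {a b t : ℝ} (ha : 0 ≤ a) (ht : 0 ≤ t) (hb : 0 ≤ b) (hab : a - t ≤ b) : a ^ 2 - 2 * a * t ≤ b ^ 2 := by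
  rcases le_or_gt a t with h | h
  · nlinarith [mul_nonneg ha (by linarith : 0 ≤ 2 * t - a), sq_nonneg b]
  · nlinarith

omit hK in
/-- ONE BOND: if `‖V − U‖ ≤ ε` (operator norm) then `‖p − Vq‖² ≥ ‖p − Uq‖² − 2ε‖q‖(‖p‖ + ‖q‖)` for `p, q` in the fibre and unitary `U`. [folklore] -/
theorem norm_covDiff_sq_ge_of_near {U V : Matrix n n 𝕜} (hU : U ∈ Matrix.unitaryGroup n 𝕜) {ε : ℝ} (hε : ‖V - U‖ ≤ ε) (p q : EuclideanSpace 𝕜 n) :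
    ‖p - Matrix.toEuclideanLin U q‖ ^ 2 - 2 * ε * ‖q‖ * (‖p‖ + ‖q‖) ≤ ‖p - Matrix.toEuclideanLin V q‖ ^ 2 := by
  have hε0 : 0 ≤ ε := (norm_nonneg _).trans hε
  have hdiff : ‖Matrix.toEuclideanLin V q - Matrix.toEuclideanLin U q‖ ≤ ε * ‖q‖ := by
    rw [← LinearMap.sub_apply, ← map_sub, Matrix.toLpLin_apply]
    calc ‖(toLp 2 ((V - U) *ᵥ ofLp q) : EuclideanSpace 𝕜 n)‖ ≤ ‖V - U‖ * ‖(toLp 2 (ofLp q) : EuclideanSpace 𝕜 n)‖ := Matrix.l2_opNorm_mulVec _ _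
      _ ≤ ε * ‖q‖ := by rw [toLp_ofLp]; exact mul_le_mul_of_nonneg_right hε (norm_nonneg _)
  have htri : ‖p - Matrix.toEuclideanLin U q‖ - ε * ‖q‖ ≤ ‖p - Matrix.toEuclideanLin V q‖ := by
    have := norm_sub_le_norm_sub_add_norm_sub (p - Matrix.toEuclideanLin U q) (Matrix.toEuclideanLin V q - Matrix.toEuclideanLin U q) (0 : EuclideanSpace 𝕜 n)
    have h2 : ‖p - Matrix.toEuclideanLin U q‖ ≤ ‖p - Matrix.toEuclideanLin V q‖ + ‖Matrix.toEuclideanLin V q - Matrix.toEuclideanLin U q‖ := by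
      have := norm_sub_le_norm_sub_add_norm_sub p (Matrix.toEuclideanLin V q) (Matrix.toEuclideanLin U q)
      linarith [norm_sub_rev (Matrix.toEuclideanLin V q) (Matrix.toEuclideanLin U q)]
    linarith
  have hU1 : ‖p - Matrix.toEuclideanLin U q‖ ≤ ‖p‖ + ‖q‖ := by
    calc ‖p - Matrix.toEuclideanLin U q‖ ≤ ‖p‖ + ‖Matrix.toEuclideanLin U q‖ := norm_sub_le _ _
      _ = ‖p‖ + ‖q‖ := by rw [norm_toEuclideanLin_of_mem_unitaryGroup hU]
  have h := sq_ge_sq_sub_of_ge_sub (norm_nonneg _) (by positivity : 0 ≤ ε * ‖q‖) (norm_nonneg _) htri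
  nlinarith [h, hU1, norm_nonneg p, norm_nonneg q, mul_nonneg hε0 (norm_nonneg q)]

/-- ★★ **COERCIVITY IS LIPSCHITZ IN THE LINK FIELD**: unitary `U, V` with `‖V_b − U_b‖ ≤ ε` on every bond and a form bound `κ·Σ‖v_x‖² ≤ Re⟨v,(−cΔ_U+m²)v⟩` (`c ≥ 0`) give
`(κ − 4(d+1)cε)·Σ‖v_x‖² ≤ Re⟨v,(−cΔ_V+m²)v⟩` — the regular regime is an OPEN condition. [cite: Balaban1985BackgroundPropagators, (3.23) p.394, (3.35) p.397; King1986, (4.4) p.670] -/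
theorem re_quadForm_covLapF_ge_of_near (hc : 0 ≤ c) (m2 : ℝ) {U V : Tor K × Fin (d + 1) → Matrix n n 𝕜} (hU : ∀ b, U b ∈ Matrix.unitaryGroup n 𝕜)
    (hV : ∀ b, V b ∈ Matrix.unitaryGroup n 𝕜) {ε : ℝ} (hε : ∀ b, ‖V b - U b‖ ≤ ε) {κ : ℝ}
    (hcoer : ∀ v : Tor K × n → 𝕜, κ * ∑ x, ‖fib K v x‖ ^ 2 ≤ RCLike.re (star v ⬝ᵥ (covLapF K c m2 U *ᵥ v))) (v : Tor K × n → 𝕜) :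
    (κ - 4 * ((d : ℝ) + 1) * c * ε) * ∑ x, ‖fib K v x‖ ^ 2 ≤ RCLike.re (star v ⬝ᵥ (covLapF K c m2 V *ᵥ v)) := by
  have hε0 : 0 ≤ ε := (norm_nonneg _).trans (hε ((0 : Tor K), 0))
  have hUform := re_quadForm_covLapF K c m2 hU v
  have hVform := re_quadForm_covLapF K c m2 hV v
  have hκ := hcoer v
  rw [hUform] at hκ
  rw [hVform]
  set S := ∑ x, ‖fib K v x‖ ^ 2 with hS
  -- bondwise comparison
  have hbond : ∀ x μ, ‖fib K v x - Matrix.toEuclideanLin (U (x, μ)) (fib K v (x + unitVec K μ))‖ ^ 2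
      - 2 * ε * ‖fib K v (x + unitVec K μ)‖ * (‖fib K v x‖ + ‖fib K v (x + unitVec K μ)‖)
      ≤ ‖fib K v x - Matrix.toEuclideanLin (V (x, μ)) (fib K v (x + unitVec K μ))‖ ^ 2 :=
    fun x μ => norm_covDiff_sq_ge_of_near (hU (x, μ)) (hε (x, μ)) _ _
  -- the error terms sum to at most `4(d+1)ε·S`
  have herr : ∑ x, ∑ μ : Fin (d + 1), 2 * ε * ‖fib K v (x + unitVec K μ)‖ * (‖fib K v x‖ + ‖fib K v (x + unitVec K μ)‖) ≤ 4 * ((d : ℝ) + 1) * ε * S := by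
    have hpt : ∀ x (μ : Fin (d + 1)), 2 * ε * ‖fib K v (x + unitVec K μ)‖ * (‖fib K v x‖ + ‖fib K v (x + unitVec K μ)‖)
        ≤ ε * (‖fib K v x‖ ^ 2 + 3 * ‖fib K v (x + unitVec K μ)‖ ^ 2) := fun x μ => by
      nlinarith [sq_nonneg (‖fib K v x‖ - ‖fib K v (x + unitVec K μ)‖), norm_nonneg (fib K v x), norm_nonneg (fib K v (x + unitVec K μ)), hε0]
    calc ∑ x, ∑ μ : Fin (d + 1), 2 * ε * ‖fib K v (x + unitVec K μ)‖ * (‖fib K v x‖ + ‖fib K v (x + unitVec K μ)‖)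
        ≤ ∑ x, ∑ μ : Fin (d + 1), ε * (‖fib K v x‖ ^ 2 + 3 * ‖fib K v (x + unitVec K μ)‖ ^ 2) := Finset.sum_le_sum fun x _ => Finset.sum_le_sum fun μ _ => hpt x μ
      _ = ∑ μ : Fin (d + 1), ∑ x, ε * (‖fib K v x‖ ^ 2 + 3 * ‖fib K v (x + unitVec K μ)‖ ^ 2) := Finset.sum_comm
      _ = ∑ _μ : Fin (d + 1), ε * (4 * S) := Finset.sum_congr rfl fun μ _ => by
          rw [← Finset.mul_sum, Finset.sum_add_distrib, ← Finset.mul_sum, sum_norm_fib_add_unitVec K v μ, ← hS]; ring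
      _ = 4 * ((d : ℝ) + 1) * ε * S := by
          rw [Finset.sum_const, Finset.card_univ, Fintype.card_fin, nsmul_eq_mul]; push_cast; ring
  have hsum : ∑ x, ∑ μ, ‖fib K v x - Matrix.toEuclideanLin (U (x, μ)) (fib K v (x + unitVec K μ))‖ ^ 2 - 4 * ((d : ℝ) + 1) * ε * S
      ≤ ∑ x, ∑ μ, ‖fib K v x - Matrix.toEuclideanLin (V (x, μ)) (fib K v (x + unitVec K μ))‖ ^ 2 := by
    have h1 : ∑ x, ∑ μ, (‖fib K v x - Matrix.toEuclideanLin (U (x, μ)) (fib K v (x + unitVec K μ))‖ ^ 2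
        - 2 * ε * ‖fib K v (x + unitVec K μ)‖ * (‖fib K v x‖ + ‖fib K v (x + unitVec K μ)‖))
        ≤ ∑ x, ∑ μ, ‖fib K v x - Matrix.toEuclideanLin (V (x, μ)) (fib K v (x + unitVec K μ))‖ ^ 2 :=
      Finset.sum_le_sum fun x _ => Finset.sum_le_sum fun μ _ => hbond x μ
    simp_rw [Finset.sum_sub_distrib] at h1
    linarith [herr]
  nlinarith [hsum, hκ, hc, mul_le_mul_of_nonneg_left hsum hc]

/-- ★ **COERCIVITY BOUNDS THE GAUSSIAN NORMALISATION**: `κ ≥ 0` and `κ·Σ‖v_x‖² ≤ Re⟨v,(−cΔ_U+m²)v⟩` for all `v` ⟹ `κ^{|T × n|} ≤ Re det(−cΔ_U+m²)` (Ϳ-m's engine, `κ`-abstract).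
[cite: Balaban1982Higgs2, (3.38) p.591; King1986, (3.89) p.668] -/
theorem pow_le_re_det_covLapF_of_coercive (c m2 : ℝ) (U : Tor K × Fin (d + 1) → Matrix n n 𝕜) {κ : ℝ} (hκ : 0 ≤ κ)
    (hcoer : ∀ v : Tor K × n → 𝕜, κ * ∑ x, ‖fib K v x‖ ^ 2 ≤ RCLike.re (star v ⬝ᵥ (covLapF K c m2 U *ᵥ v))) :
    κ ^ Fintype.card (Tor K × n) ≤ RCLike.re ((covLapF K c m2 U).det) := by
  rw [det_covLapF_eq_ofReal_prod, RCLike.ofReal_re]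
  exact prod_eigenvalues_ge_pow (hκ := hκ) fun i => eigenvalues_covLapF_ge_of_coercive K c m2 U hcoer i

end Generic

/-! ## §2 The Landau mass on and near the gauge orbit of the flux field -/

section Orbit

variable [hK : ∀ μ, NeZero (K μ)] {c : ℝ}

/-- ★★ Every gauge transform of the Landau-gauge flux field has the Landau mass: `(m² + cΛ(p′_{ν₀}))·Σ‖v_x‖² ≤ Re⟨v,(−cΔ_{U₀^g}+m²)v⟩`.
[cite: Balaban1985BackgroundPropagators, p.398 l.19; King1986, (4.4) p.670] -/
theorem re_quadForm_covLapF_ge_landau_gauge (hc : 0 ≤ c) (m2 : ℝ) {p : Tor K} {ν₀ ν₁ : Fin (d + 1)} (hν : ν₀ ≠ ν₁) (hp : p ν₁ = 0) {g : Tor K → Matrix Unit Unit ℂ}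
    (hg : ∀ x, g x ∈ Matrix.unitaryGroup Unit ℂ) (v : Tor K × Unit → ℂ) :
    (m2 + c * landauGap (sOf K p ν₀)) * ∑ x, ‖fib K v x‖ ^ 2 ≤ RCLike.re (star v ⬝ᵥ (covLapF K c m2 (kingGaugeAct K g (fluxLink K p ν₁)) *ᵥ v)) :=
  coercive_kingGaugeAct K c m2 hg (fun w => re_quadForm_covLapF_fluxLink_ge_landau K hc m2 hν hp w) v

/-- ★★★ **THE LANDAU MASS ON A TUBE AROUND THE GAUGE ORBIT**: every unitary `U(1)` field `V` with `‖V_b − (U₀^g)_b‖ ≤ ε` on all bonds, for some unitary gauge `g` and the Landau-gauge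
flux field `U₀ = fluxLink p ν₁` (`p_{ν₁} = 0`, `ν₀ ≠ ν₁`, `c ≥ 0`), satisfies `(m² + cΛ(p′_{ν₀}) − 4(d+1)cε)·Σ‖v_x‖² ≤ Re⟨v,(−cΔ_V+m²)v⟩` — the linear-in-flux gap persists on an open
set of fields of NON-CONSTANT curvature. [cite: Balaban1985BackgroundPropagators, (3.35) p.397, p.398 l.19; King1986, (4.4) p.670] -/
theorem re_quadForm_covLapF_ge_landau_near_orbit (hc : 0 ≤ c) (m2 : ℝ) {p : Tor K} {ν₀ ν₁ : Fin (d + 1)} (hν : ν₀ ≠ ν₁) (hp : p ν₁ = 0) {g : Tor K → Matrix Unit Unit ℂ}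
    (hg : ∀ x, g x ∈ Matrix.unitaryGroup Unit ℂ) {V : Tor K × Fin (d + 1) → Matrix Unit Unit ℂ} (hV : ∀ b, V b ∈ Matrix.unitaryGroup Unit ℂ) {ε : ℝ}
    (hε : ∀ b, ‖V b - kingGaugeAct K g (fluxLink K p ν₁) b‖ ≤ ε) (v : Tor K × Unit → ℂ) :
    (m2 + c * landauGap (sOf K p ν₀) - 4 * ((d : ℝ) + 1) * c * ε) * ∑ x, ‖fib K v x‖ ^ 2 ≤ RCLike.re (star v ⬝ᵥ (covLapF K c m2 V *ᵥ v)) :=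
  re_quadForm_covLapF_ge_of_near K hc m2 (kingGaugeAct_mem_unitaryGroup K hg (fluxLink_mem_unitaryGroup K p ν₁)) hV hε
    (fun w => re_quadForm_covLapF_ge_landau_gauge K hc m2 hν hp hg w) v

/-- ★★ **THE MASSLESS COVARIANT LAPLACIAN IS POSITIVE DEFINITE ON THE TUBE**: `c > 0`, `p_{ν₀} ≠ 0`, `|p′_{ν₀}| ≤ 1`, and `4(d+1)ε < Λ(p′_{ν₀})` ⟹ `−cΔ_V ≻ 0` for every `V` as above, with
every eigenvalue `≥ c(Λ(p′) − 4(d+1)ε) > 0`. [cite: DodziukMathai2006, Cor 1.3 §1; Balaban1985BackgroundPropagators, (3.35) p.397] -/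
theorem posDef_covLapF_massless_near_landau_orbit (hc : 0 < c) {p : Tor K} {ν₀ ν₁ : Fin (d + 1)} (hν : ν₀ ≠ ν₁) (hp : p ν₁ = 0) {g : Tor K → Matrix Unit Unit ℂ}
    (hg : ∀ x, g x ∈ Matrix.unitaryGroup Unit ℂ) {V : Tor K × Fin (d + 1) → Matrix Unit Unit ℂ} (hV : ∀ b, V b ∈ Matrix.unitaryGroup Unit ℂ) {ε : ℝ}
    (hε : ∀ b, ‖V b - kingGaugeAct K g (fluxLink K p ν₁) b‖ ≤ ε) (hsmall : 4 * ((d : ℝ) + 1) * ε < landauGap (sOf K p ν₀)) :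
    (covLapF K c 0 V).PosDef := by
  have hκ : 0 < 0 + c * landauGap (sOf K p ν₀) - 4 * ((d : ℝ) + 1) * c * ε := by nlinarith
  exact posDef_covLapF_of_coercive K c 0 V hκ fun w => re_quadForm_covLapF_ge_landau_near_orbit K hc.le 0 hν hp hg hV hε w

/-- ★★ `‖(−cΔ_V+m²)⁻¹‖ ≤ (m² + cΛ(p′_{ν₀}) − 4(d+1)cε)⁻¹` on the tube whenever the right side is positive. [cite: Balaban1985BackgroundPropagators, (3.39) p.397] -/
theorem l2_opNorm_covLapF_inv_le_near_landau_orbit (hc : 0 ≤ c) {m2 : ℝ} {p : Tor K} {ν₀ ν₁ : Fin (d + 1)} (hν : ν₀ ≠ ν₁) (hp : p ν₁ = 0) {g : Tor K → Matrix Unit Unit ℂ}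
    (hg : ∀ x, g x ∈ Matrix.unitaryGroup Unit ℂ) {V : Tor K × Fin (d + 1) → Matrix Unit Unit ℂ} (hV : ∀ b, V b ∈ Matrix.unitaryGroup Unit ℂ) {ε : ℝ}
    (hε : ∀ b, ‖V b - kingGaugeAct K g (fluxLink K p ν₁) b‖ ≤ ε) (hpos : 0 < m2 + c * landauGap (sOf K p ν₀) - 4 * ((d : ℝ) + 1) * c * ε) :
    ‖(covLapF K c m2 V)⁻¹‖ ≤ (m2 + c * landauGap (sOf K p ν₀) - 4 * ((d : ℝ) + 1) * c * ε)⁻¹ :=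
  l2_opNorm_covLapF_inv_le_of_coercive K c m2 V hpos fun w => re_quadForm_covLapF_ge_landau_near_orbit K hc m2 hν hp hg hV hε w

end Orbit

/-! ## §3 The curved Gaussian normalisation -/

section Determinant

variable [hK : ∀ μ, NeZero (K μ)] {c : ℝ}

/-- ★★ **`(m² + cΛ(p′_{ν₀}))^{|T|} ≤ Re det(−cΔ_{U₀}+m²)`** at the Landau-gauge flux field (`m² + cΛ ≥ 0`; `|T × Unit| = |T|` factors) — Ϳ-m's plaquette bound `(m² + 2c(2−2cos(p′∕4)))^{|T|}`
improved to the linear Landau mass at small flux. [cite: Balaban1982Higgs2, (3.38) p.591; King1986, (3.89) p.668] -/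
theorem pow_landau_le_re_det_covLapF_fluxLink (hc : 0 ≤ c) (m2 : ℝ) {p : Tor K} {ν₀ ν₁ : Fin (d + 1)} (hν : ν₀ ≠ ν₁) (hp : p ν₁ = 0) (hκ : 0 ≤ m2 + c * landauGap (sOf K p ν₀)) :
    (m2 + c * landauGap (sOf K p ν₀)) ^ Fintype.card (Tor K × Unit) ≤ ((covLapF K c m2 (fluxLink K p ν₁)).det).re :=
  pow_le_re_det_covLapF_of_coercive K c m2 _ hκ fun v => re_quadForm_covLapF_fluxLink_ge_landau K hc m2 hν hp v

/-- ★ The same on the tube around the gauge orbit: `(m² + cΛ(p′) − 4(d+1)cε)^{|T|} ≤ Re det(−cΔ_V+m²)` (left base `≥ 0`). [cite: Balaban1982Higgs2, (3.38) p.591] -/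
theorem pow_landau_le_re_det_near_orbit (hc : 0 ≤ c) (m2 : ℝ) {p : Tor K} {ν₀ ν₁ : Fin (d + 1)} (hν : ν₀ ≠ ν₁) (hp : p ν₁ = 0) {g : Tor K → Matrix Unit Unit ℂ}
    (hg : ∀ x, g x ∈ Matrix.unitaryGroup Unit ℂ) {V : Tor K × Fin (d + 1) → Matrix Unit Unit ℂ} (hV : ∀ b, V b ∈ Matrix.unitaryGroup Unit ℂ) {ε : ℝ}
    (hε : ∀ b, ‖V b - kingGaugeAct K g (fluxLink K p ν₁) b‖ ≤ ε) (hκ : 0 ≤ m2 + c * landauGap (sOf K p ν₀) - 4 * ((d : ℝ) + 1) * c * ε) :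
    (m2 + c * landauGap (sOf K p ν₀) - 4 * ((d : ℝ) + 1) * c * ε) ^ Fintype.card (Tor K × Unit) ≤ ((covLapF K c m2 V).det).re :=
  pow_le_re_det_covLapF_of_coercive K c m2 V hκ fun w => re_quadForm_covLapF_ge_landau_near_orbit K hc m2 hν hp hg hV hε w

/-- ★ **THE MASSLESS CURVED NORMALISATION IS POSITIVE ON THE TUBE**: `det(−cΔ_V) > 0` (real part) whenever `c > 0` and `4(d+1)ε < Λ(p′_{ν₀})` — versus King's `det(c(−Δ)) = 0`.
[cite: Balaban1982Higgs2, (3.38) p.591; King1986, (3.89) p.668] -/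
theorem re_det_covLapF_massless_pos_near_orbit (hc : 0 < c) {p : Tor K} {ν₀ ν₁ : Fin (d + 1)} (hν : ν₀ ≠ ν₁) (hp : p ν₁ = 0) {g : Tor K → Matrix Unit Unit ℂ}
    (hg : ∀ x, g x ∈ Matrix.unitaryGroup Unit ℂ) {V : Tor K × Fin (d + 1) → Matrix Unit Unit ℂ} (hV : ∀ b, V b ∈ Matrix.unitaryGroup Unit ℂ) {ε : ℝ}
    (hε : ∀ b, ‖V b - kingGaugeAct K g (fluxLink K p ν₁) b‖ ≤ ε) (hsmall : 4 * ((d : ℝ) + 1) * ε < landauGap (sOf K p ν₀)) :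
    0 < ((covLapF K c 0 V).det).re := by
  have hκ : 0 < 0 + c * landauGap (sOf K p ν₀) - 4 * ((d : ℝ) + 1) * c * ε := by nlinarith
  exact lt_of_lt_of_le (pow_pos hκ _) (pow_landau_le_re_det_near_orbit K hc.le 0 hν hp hg hV hε hκ.le)

end Determinant

end Summit.QuantumFields.YangMills.BalabanUVNodes.N15KingModelRung.Landau

end
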